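import Summits.AtomisticToContinuum.Crystallization.Theorems.FrustratedLawDichotomyStrainedPatchHomValueT2SoundN
import Summits.AtomisticToContinuum.Crystallization.Theorems.FrustratedLawDichotomyStrainedPatchHomValueT2SoundF
import Summits.AtomisticToContinuum.Crystallization.Theorems.FrustratedLawDichotomyStrainedPatchTaylorRegular
import Mathlib.Analysis.Calculus.MeanValue

/-!
# (I1) part P — the PER-LABEL CALCULUS ALONG THE BILINEAR SEGMENT of the joint value leaf (`…HomValueT2KitL` §12, Design J; roadmap for
# `valueLeafT2J_sound`, step 2): the label point `y(t) = (V + tΔU)(q + tΔξ)` (`V = U_c`, `ΔU = U − U_c` symmetric, `Δξ = ξ − ξ_c`), its folded first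
# derivatives `dyR` are AFFINE in `t` with slope `Σ_m ddyR·δ_m`, hence ★ `ζ_k′ = Σ_m ν_km δ_m`, ★ `ν_kl′ = Σ_m ω_klm δ_m`; ★ the slope `β(ρ)Σ_k ζ_k δ_k` has
# derivative `Σ_kl (αζ_kζ_l + βν_kl) δ_kδ_l` at every parameter whose radius is off the junction radii (ALL four regimes); ★★ inside one open regime the
# Hessian entry `αζ_kζ_l + βν_kl` has derivative `Σ_m T_klm δ_m` with EXACTLY the `T` of `…SoundN.mem_thirdOf`; ★ the radius of a quadratic path meets a
# value `r ≠ ‖y(0)‖` only finitely often (so the junction parameters of a label whose centre radius is off the junctions form a finite set)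
# (27623 `(H) HomFloor`, hcp half; decomp-a2c hand-1 g49; critic row 1674 (B) (I1) docket).

No definitions; 0 sorry; standard axioms; no instances / notation / `#eval`.  `--supports stmt-AtomisticToContinuum-27623`.
-/

noncomputable section

namespace Summit.AtomisticToContinuum.Crystallization.Theorems.FrustratedLawDichotomyStrainedPatchHomValueT2Kit

open scoped BigOperators RealInnerProductSpace
open Finset
open Literature.Analysis.ValidatedNumerics.Numerics
open Summit.AtomisticToContinuum.Crystallization.Theorems.ChargedEnergyGapNegative (E3)
open Summit.AtomisticToContinuum.Crystallization.Theorems.FrustratedLawDichotomySchurCut (effPot w₄₅ ω₄)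
open Summit.AtomisticToContinuum.Crystallization.Theorems.FrustratedLawDichotomyStrainedPatchTaylorLeaves (junctions)
open Summit.AtomisticToContinuum.Crystallization.Theorems.FrustratedLawDichotomyStrainedPatchHomCoords (apply_eq_sum_entries)
open Summit.AtomisticToContinuum.Crystallization.Theorems.FrustratedLawDichotomyStrainedPatchTaylorRegular (differentiableAt_deriv_Wrec)

/-! ## §1. The bilinear label path and its derivatives -/

section Path

variable (V ΔU : E3 →L[ℝ] E3) (q Δξ : E3)

/-- Entries along the path: `ent (V + tΔU) a b = ent V a b + t·ent ΔU a b`. [formal bookkeeping] -/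
theorem ent_path (a b : Fin 3) (t : ℝ) : ent (V + t • ΔU) a b = ent V a b + t * ent ΔU a b := by simp [ent]

/-- Coordinates along the path: `(q + tΔξ)_l = q_l + t·Δξ_l`. [formal bookkeeping] -/
theorem coord_path (l : Fin 3) (t : ℝ) : (q + t • Δξ) l = q l + t * Δξ l := by simp

/-- `((V + tΔU)(q + tΔξ))_c = Σ_l (V_cl + tΔU_cl)(q_l + tΔξ_l)`. [formal bookkeeping] -/
theorem apply_path (cc : Fin 3) (t : ℝ) :
    ((V + t • ΔU) (q + t • Δξ)) cc = ∑ l : Fin 3, (ent V cc l + t * ent ΔU cc l) * (q l + t * Δξ l) := by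
  rw [apply_eq_sum_entries]
  refine Finset.sum_congr rfl fun l _ => ?_
  rw [coord_path, ← ent_path]; rfl

/-- ★ The label path `t ↦ (V + tΔU)(q + tΔξ)` has derivative `ΔU(q + sΔξ) + (V + sΔU)Δξ` at `s`. [folklore: product rule] -/
theorem hasDerivAt_labelPath (s : ℝ) :
    HasDerivAt (fun t : ℝ => (V + t • ΔU) (q + t • Δξ)) (ΔU (q + s • Δξ) + (V + s • ΔU) Δξ) s := by
  have hc : HasDerivAt (fun t : ℝ => V + t • ΔU) ΔU s := by simpa using ((hasDerivAt_id s).smul_const ΔU).const_add V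
  have hu : HasDerivAt (fun t : ℝ => q + t • Δξ) Δξ s := by simpa using ((hasDerivAt_id s).smul_const Δξ).const_add q
  exact hc.clm_apply hu

/-- ★ The path velocity `t ↦ ΔU(q + tΔξ) + (V + tΔU)Δξ` has derivative `2·ΔUΔξ`. [folklore] -/
theorem hasDerivAt_labelVel (s : ℝ) :
    HasDerivAt (fun t : ℝ => ΔU (q + t • Δξ) + (V + t • ΔU) Δξ) ((2 : ℝ) • ΔU Δξ) s := by
  have hc : HasDerivAt (fun t : ℝ => V + t • ΔU) ΔU s := by simpa using ((hasDerivAt_id s).smul_const ΔU).const_add V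
  have hu : HasDerivAt (fun t : ℝ => q + t • Δξ) Δξ s := by simpa using ((hasDerivAt_id s).smul_const Δξ).const_add q
  have h1 : HasDerivAt (fun t : ℝ => ΔU (q + t • Δξ)) (ΔU Δξ) s := by simpa using (hasDerivAt_const s ΔU).clm_apply hu
  have h2 : HasDerivAt (fun t : ℝ => (V + t • ΔU) Δξ) (ΔU Δξ) s := by simpa using hc.clm_apply (hasDerivAt_const s Δξ)
  exact (h1.add h2).congr_deriv (by rw [two_smul])

/-- The label path as a quadratic polynomial path: `(V + tΔU)(q + tΔξ) = Vq + t·(ΔUq + VΔξ) + t²·ΔUΔξ`. [arithmetic] -/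
theorem labelPath_eq (t : ℝ) : (V + t • ΔU) (q + t • Δξ) = V q + t • (ΔU q + V Δξ) + t ^ 2 • ΔU Δξ := by
  have e1 : (V + t • ΔU) (q + t • Δξ) = V (q + t • Δξ) + t • ΔU (q + t • Δξ) := rfl
  simp only [e1, map_add, map_smul, smul_add, smul_smul, sq]
  abel

/-- ★ Components of the path are differentiable with the components of the velocity. [folklore] -/
theorem hasDerivAt_apply_path (cc : Fin 3) (s : ℝ) :
    HasDerivAt (fun t : ℝ => ((V + t • ΔU) (q + t • Δξ)) cc) ((ΔU (q + s • Δξ) + (V + s • ΔU) Δξ) cc) s := by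
  have hfun : (fun t : ℝ => ((V + t • ΔU) (q + t • Δξ)) cc) = fun t => ∑ l : Fin 3, (ent V cc l + t * ent ΔU cc l) * (q l + t * Δξ l) := by
    funext t; exact apply_path V ΔU q Δξ cc t
  rw [hfun]
  have h : HasDerivAt (fun t : ℝ => ∑ l : Fin 3, (ent V cc l + t * ent ΔU cc l) * (q l + t * Δξ l))
      (∑ l : Fin 3, (ent ΔU cc l * (q l + s * Δξ l) + (ent V cc l + s * ent ΔU cc l) * Δξ l)) s := by
    refine HasDerivAt.fun_sum fun l _ => ?_
    have h1 : HasDerivAt (fun t : ℝ => ent V cc l + t * ent ΔU cc l) (ent ΔU cc l) s := by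
      simpa using ((hasDerivAt_id s).mul_const (ent ΔU cc l)).const_add (ent V cc l)
    have h2 : HasDerivAt (fun t : ℝ => q l + t * Δξ l) (Δξ l) s := by simpa using ((hasDerivAt_id s).mul_const (Δξ l)).const_add (q l)
    exact (h1.mul h2).congr_deriv (by ring)
  refine h.congr_deriv ?_
  rw [PiLp.add_apply, apply_eq_sum_entries ΔU, apply_eq_sum_entries (V + s • ΔU), ← Finset.sum_add_distrib]
  refine Finset.sum_congr rfl fun l _ => ?_
  show ent ΔU cc l * (q l + s * Δξ l) + (ent V cc l + s * ent ΔU cc l) * Δξ l = ent ΔU cc l * (q + s • Δξ) l + ent (V + s • ΔU) cc l * Δξ l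
  rw [coord_path, ent_path]

/-! ## §2. The folded first derivatives are affine along the path -/

/-- `ddyR` is symmetric. [formal bookkeeping] -/
theorem ddyR_symm (k l : ℕ) (cc : Fin 3) : ddyR k l cc = ddyR l k cc := by
  unfold ddyR
  by_cases h1 : k < 6 ∧ 6 ≤ l ∧ l < 9
  · have h2 : ¬ (l < 6 ∧ 6 ≤ k ∧ k < 9) := by omega
    rw [if_pos h1, if_neg h2, if_pos h1]
  · rw [if_neg h1]
    by_cases h2 : l < 6 ∧ 6 ≤ k ∧ k < 9
    · rw [if_pos h2, if_pos h2]
    · rw [if_neg h2, if_neg h2, if_neg h1]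

/-- ★ **`dyR` IS AFFINE ALONG THE PATH** (symmetric `ΔU`): `(∂_k y)_c(t) = (∂_k y)_c(0) + t·Σ_m (∂_k∂_m y)_c δ_m` (`k < 9`). [folklore: expansion in entries] -/
theorem dyR_path (hsym : ∀ a b : Fin 3, ent ΔU a b = ent ΔU b a) {k : ℕ} (hk : k < 9) (cc : Fin 3) (t : ℝ) :
    dyR (V + t • ΔU) (q + t • Δξ) k cc = dyR V q k cc + t * ∑ m ∈ range 9, ddyR k m cc * dispN ΔU Δξ m := by
  have h10 := hsym 1 0; have h20 := hsym 2 0; have h21 := hsym 2 1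
  simp only [ent] at h10 h20 h21
  interval_cases k <;> fin_cases cc <;> simp [dyR, ddyR, ddyU, dispN, ent, Finset.sum_range_succ, h10, h20, h21]

/-- ★ `dyR` is differentiable along the path with CONSTANT derivative `Σ_m (∂_k∂_m y)_c δ_m`. [folklore] -/
theorem hasDerivAt_dyR_path (hsym : ∀ a b : Fin 3, ent ΔU a b = ent ΔU b a) {k : ℕ} (hk : k < 9) (cc : Fin 3) (s : ℝ) :
    HasDerivAt (fun t : ℝ => dyR (V + t • ΔU) (q + t • Δξ) k cc) (∑ m ∈ range 9, ddyR k m cc * dispN ΔU Δξ m) s := by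
  have hfun : (fun t : ℝ => dyR (V + t • ΔU) (q + t • Δξ) k cc) = fun t => dyR V q k cc + t * ∑ m ∈ range 9, ddyR k m cc * dispN ΔU Δξ m := by
    funext t; exact dyR_path V ΔU q Δξ hsym hk cc t
  rw [hfun]
  simpa using ((hasDerivAt_id s).mul_const (∑ m ∈ range 9, ddyR k m cc * dispN ΔU Δξ m)).const_add (dyR V q k cc)

/-! ## §3. ★ `ζ′ = Σ ν δ` and `ν′ = Σ ω δ` along the path -/

/-- ★★ **`ζ_k′ = Σ_m ν_km δ_m`** along the path (`k < 9`, symmetric `ΔU`). [folklore: product rule + `…SoundJ.dy_apply_eq_sum`] -/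
theorem hasDerivAt_zetaN_path (hsym : ∀ a b : Fin 3, ent ΔU a b = ent ΔU b a) {k : ℕ} (hk : k < 9) (s : ℝ) :
    HasDerivAt (fun t : ℝ => zetaN (V + t • ΔU) (q + t • Δξ) k)
      (∑ m ∈ range 9, nuR (V + s • ΔU) (q + s • Δξ) k m * dispN ΔU Δξ m) s := by
  have hfun : (fun t : ℝ => zetaN (V + t • ΔU) (q + t • Δξ) k) =
      fun t => ∑ cc : Fin 3, ((V + t • ΔU) (q + t • Δξ)) cc * dyR (V + t • ΔU) (q + t • Δξ) k cc := by
    funext t; exact zetaN_eq_sum _ _ hk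
  rw [hfun]
  have h := HasDerivAt.fun_sum (u := (Finset.univ : Finset (Fin 3))) fun cc _ =>
    (hasDerivAt_apply_path V ΔU q Δξ cc s).mul (hasDerivAt_dyR_path V ΔU q Δξ hsym hk cc s)
  refine h.congr_deriv ?_
  set Vs := V + s • ΔU with hVs
  set qs := q + s • Δξ with hqs
  have e : ∀ cc : Fin 3, (ΔU qs + Vs Δξ) cc * dyR Vs qs k cc + (Vs qs) cc * ∑ m ∈ range 9, ddyR k m cc * dispN ΔU Δξ m =
      ∑ m ∈ range 9, (dyR Vs qs k cc * dyR Vs qs m cc + (Vs qs) cc * ddyR k m cc) * dispN ΔU Δξ m := by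
    intro cc
    rw [dy_apply_eq_sum Vs ΔU hsym qs Δξ cc, Finset.sum_mul, Finset.mul_sum, ← Finset.sum_add_distrib]
    refine Finset.sum_congr rfl fun m _ => ?_
    ring
  rw [Finset.sum_congr rfl fun cc _ => e cc, Finset.sum_comm]
  refine Finset.sum_congr rfl fun m _ => ?_
  rw [nuR, Finset.sum_mul]

/-- ★★ **`ν_kl′ = Σ_m ω_klm δ_m`** along the path (`k, l < 9`, symmetric `ΔU`), with the real `ω_klm` written out exactly as in `…SoundN.mem_omg`
(`a = k`, `b = l`). [folklore: product rule + `…SoundJ.dy_apply_eq_sum`] -/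
theorem hasDerivAt_nuR_path (hsym : ∀ a b : Fin 3, ent ΔU a b = ent ΔU b a) {k l : ℕ} (hk : k < 9) (hl : l < 9) (s : ℝ) :
    HasDerivAt (fun t : ℝ => nuR (V + t • ΔU) (q + t • Δξ) k l)
      (∑ m ∈ range 9, (∑ cc : Fin 3, (dyR (V + s • ΔU) (q + s • Δξ) l cc * ddyR m k cc + dyR (V + s • ΔU) (q + s • Δξ) k cc * ddyR m l cc +
        dyR (V + s • ΔU) (q + s • Δξ) m cc * ddyR k l cc)) * dispN ΔU Δξ m) s := by
  unfold nuR
  have h := HasDerivAt.fun_sum (u := (Finset.univ : Finset (Fin 3))) fun cc _ =>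
    ((hasDerivAt_dyR_path V ΔU q Δξ hsym hk cc s).mul (hasDerivAt_dyR_path V ΔU q Δξ hsym hl cc s)).add
      ((hasDerivAt_apply_path V ΔU q Δξ cc s).mul_const (ddyR k l cc))
  refine h.congr_deriv ?_
  set Vs := V + s • ΔU with hVs
  set qs := q + s • Δξ with hqs
  have e : ∀ cc : Fin 3, (∑ m ∈ range 9, ddyR k m cc * dispN ΔU Δξ m) * dyR Vs qs l cc + dyR Vs qs k cc * (∑ m ∈ range 9, ddyR l m cc * dispN ΔU Δξ m) +
      (ΔU qs + Vs Δξ) cc * ddyR k l cc =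
      ∑ m ∈ range 9, (dyR Vs qs l cc * ddyR m k cc + dyR Vs qs k cc * ddyR m l cc + dyR Vs qs m cc * ddyR k l cc) * dispN ΔU Δξ m := by
    intro cc
    rw [dy_apply_eq_sum Vs ΔU hsym qs Δξ cc, Finset.sum_mul, Finset.sum_mul, Finset.mul_sum, ← Finset.sum_add_distrib, ← Finset.sum_add_distrib]
    refine Finset.sum_congr rfl fun m _ => ?_
    rw [ddyR_symm m k, ddyR_symm m l]
    ring
  rw [Finset.sum_congr rfl fun cc _ => e cc, Finset.sum_comm]
  refine Finset.sum_congr rfl fun m _ => ?_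
  rw [Finset.sum_mul]

/-! ## §4. The slope of one label along the path and its derivative in every open regime -/

/-- ★ **SLOPE OF THE SLOPE, ANY REGIME**: the analogue of `…SoundF.hasDerivAt_Wslope_path` assuming only that `W₄₅′` is differentiable at `‖y s‖ > 0`
(true off the three junction radii, in all four regimes): `(β(‖y‖)⟪y, y′⟫)′ = α⟪y, y′⟫² + β(‖y′‖² + ⟪y, y″⟫)` with `β = W′/r`, `α = (W″ − W′/r)/r²`,
`W″ = deriv (deriv W)`. [folklore: quotient + chain + product rules] -/
theorem hasDerivAt_Wslope_path' {y y' : ℝ → E3} {y'' : E3} {s : ℝ} (hy : HasDerivAt y (y' s) s) (hy' : HasDerivAt y' y'' s)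
    (h0 : 0 < ‖y s‖)
    (hW : HasDerivAt (deriv (effPot w₄₅ ω₄ (3 / 400))) (deriv (deriv (effPot w₄₅ ω₄ (3 / 400))) ‖y s‖) ‖y s‖) :
    HasDerivAt (fun t => deriv (effPot w₄₅ ω₄ (3 / 400)) ‖y t‖ / ‖y t‖ * ⟪y t, y' t⟫)
      ((deriv (deriv (effPot w₄₅ ω₄ (3 / 400))) ‖y s‖ - deriv (effPot w₄₅ ω₄ (3 / 400)) ‖y s‖ / ‖y s‖) / ‖y s‖ ^ 2 * ⟪y s, y' s⟫ ^ 2 +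
        deriv (effPot w₄₅ ω₄ (3 / 400)) ‖y s‖ / ‖y s‖ * (‖y' s‖ ^ 2 + ⟪y s, y''⟫)) s := by
  have hne : ‖y s‖ ≠ 0 := h0.ne'
  have hy0 : y s ≠ 0 := norm_ne_zero_iff.1 hne
  -- `β(r) = W′(r)/r`
  have hβ : HasDerivAt (fun r => deriv (effPot w₄₅ ω₄ (3 / 400)) r / r)
      ((deriv (deriv (effPot w₄₅ ω₄ (3 / 400))) ‖y s‖ * ‖y s‖ - deriv (effPot w₄₅ ω₄ (3 / 400)) ‖y s‖ * 1) / ‖y s‖ ^ 2) ‖y s‖ :=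
    hW.div (hasDerivAt_id ‖y s‖) hne
  have hβpath := hβ.comp s (hasDerivAt_norm_path hy hy0)
  have hinner : HasDerivAt (fun t => ⟪y t, y' t⟫) (⟪y s, y''⟫ + ⟪y' s, y' s⟫) s := hy.inner ℝ hy'
  have h := hβpath.mul hinner
  refine h.congr_deriv ?_
  simp only [Function.comp_apply, real_inner_self_eq_norm_sq]
  field_simp
  ring

variable {V ΔU q Δξ}

/-- ★ **FIRST DERIVATIVE OF ONE LABEL TERM** along the path: `(W‖y‖)′(s) = β(ρ_s)·Σ_k ζ_k(s) δ_k` (`y s ≠ 0`, symmetric `ΔU`). [folklore chaining] -/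
theorem hasDerivAt_W_label (hsym : ∀ a b : Fin 3, ent ΔU a b = ent ΔU b a) {s : ℝ} (h0 : (V + s • ΔU) (q + s • Δξ) ≠ 0) :
    HasDerivAt (fun t : ℝ => effPot w₄₅ ω₄ (3 / 400) ‖(V + t • ΔU) (q + t • Δξ)‖)
      (deriv (effPot w₄₅ ω₄ (3 / 400)) ‖(V + s • ΔU) (q + s • Δξ)‖ / ‖(V + s • ΔU) (q + s • Δξ)‖ *
        ∑ k ∈ range 9, zetaN (V + s • ΔU) (q + s • Δξ) k * dispN ΔU Δξ k) s := by
  have h := hasDerivAt_W_path (hasDerivAt_labelPath V ΔU q Δξ s) h0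
  rw [inner_y_dy_eq_sum (V + s • ΔU) ΔU hsym (q + s • Δξ) Δξ] at h
  exact h

/-- The slope function of one label in the folded form equals `β(‖y‖)⟪y, y′⟫`. [formal bookkeeping] -/
theorem slope_label_eq (hsym : ∀ a b : Fin 3, ent ΔU a b = ent ΔU b a) :
    (fun t : ℝ => deriv (effPot w₄₅ ω₄ (3 / 400)) ‖(V + t • ΔU) (q + t • Δξ)‖ / ‖(V + t • ΔU) (q + t • Δξ)‖ *
        ∑ k ∈ range 9, zetaN (V + t • ΔU) (q + t • Δξ) k * dispN ΔU Δξ k) =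
      fun t : ℝ => deriv (effPot w₄₅ ω₄ (3 / 400)) ‖(V + t • ΔU) (q + t • Δξ)‖ / ‖(V + t • ΔU) (q + t • Δξ)‖ *
        ⟪(V + t • ΔU) (q + t • Δξ), ΔU (q + t • Δξ) + (V + t • ΔU) Δξ⟫ := by
  funext t
  rw [inner_y_dy_eq_sum (V + t • ΔU) ΔU hsym (q + t • Δξ) Δξ]

/-- ★★ **SECOND DERIVATIVE OF ONE LABEL TERM IN THE FOLDED HESSIAN FORM**, every open regime: at a parameter `s` with `ρ_s = ‖y s‖ > 0` off the junction
radii, the folded slope `β(ρ)Σ_k ζ_k δ_k` has derivative `Σ_k Σ_l (α ζ_k ζ_l + β ν_kl) δ_k δ_l` (`α, β` the true coefficient values at `ρ_s`).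
[folklore chaining: §4 + `…SoundI.inner_y_dy_eq_sum` + `…SoundJ.normSq_dy_add_inner_ddy_eq_sum`] -/
theorem hasDerivAt_slope_label (hsym : ∀ a b : Fin 3, ent ΔU a b = ent ΔU b a) {s : ℝ} (h0 : 0 < ‖(V + s • ΔU) (q + s • Δξ)‖)
    (hJ : ‖(V + s • ΔU) (q + s • Δξ)‖ ∉ junctions) :
    HasDerivAt (fun t : ℝ => deriv (effPot w₄₅ ω₄ (3 / 400)) ‖(V + t • ΔU) (q + t • Δξ)‖ / ‖(V + t • ΔU) (q + t • Δξ)‖ *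
        ∑ k ∈ range 9, zetaN (V + t • ΔU) (q + t • Δξ) k * dispN ΔU Δξ k)
      (∑ k ∈ range 9, ∑ l ∈ range 9,
        ((deriv (deriv (effPot w₄₅ ω₄ (3 / 400))) ‖(V + s • ΔU) (q + s • Δξ)‖ -
            deriv (effPot w₄₅ ω₄ (3 / 400)) ‖(V + s • ΔU) (q + s • Δξ)‖ / ‖(V + s • ΔU) (q + s • Δξ)‖) / ‖(V + s • ΔU) (q + s • Δξ)‖ ^ 2 *
            (zetaN (V + s • ΔU) (q + s • Δξ) k * zetaN (V + s • ΔU) (q + s • Δξ) l) +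
          deriv (effPot w₄₅ ω₄ (3 / 400)) ‖(V + s • ΔU) (q + s • Δξ)‖ / ‖(V + s • ΔU) (q + s • Δξ)‖ * nuR (V + s • ΔU) (q + s • Δξ) k l) *
        (dispN ΔU Δξ k * dispN ΔU Δξ l)) s := by
  rw [slope_label_eq hsym]
  have hW : HasDerivAt (deriv (effPot w₄₅ ω₄ (3 / 400))) (deriv (deriv (effPot w₄₅ ω₄ (3 / 400))) ‖(V + s • ΔU) (q + s • Δξ)‖)
      ‖(V + s • ΔU) (q + s • Δξ)‖ := (differentiableAt_deriv_Wrec h0 hJ).hasDerivAt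
  have h := hasDerivAt_Wslope_path' (y := fun t : ℝ => (V + t • ΔU) (q + t • Δξ)) (y' := fun t : ℝ => ΔU (q + t • Δξ) + (V + t • ΔU) Δξ)
    (hasDerivAt_labelPath V ΔU q Δξ s) (hasDerivAt_labelVel V ΔU q Δξ s) h0 hW
  refine h.congr_deriv ?_
  set Vs := V + s • ΔU with hVs
  set qs := q + s • Δξ with hqs
  set A := (deriv (deriv (effPot w₄₅ ω₄ (3 / 400))) ‖Vs qs‖ - deriv (effPot w₄₅ ω₄ (3 / 400)) ‖Vs qs‖ / ‖Vs qs‖) / ‖Vs qs‖ ^ 2 with hA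
  set B := deriv (effPot w₄₅ ω₄ (3 / 400)) ‖Vs qs‖ / ‖Vs qs‖ with hB
  have e2 : B * (‖ΔU qs + Vs Δξ‖ ^ 2 + 2 * ⟪Vs qs, ΔU Δξ⟫) = ∑ k ∈ range 9, ∑ l ∈ range 9, B * nuR Vs qs k l * (dispN ΔU Δξ k * dispN ΔU Δξ l) := by
    rw [normSq_dy_add_inner_ddy_eq_sum Vs ΔU hsym qs Δξ, Finset.mul_sum]
    exact Finset.sum_congr rfl fun k _ => by rw [Finset.mul_sum]; exact Finset.sum_congr rfl fun l _ => by ring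
  have e1 : A * (∑ k ∈ range 9, zetaN Vs qs k * dispN ΔU Δξ k) ^ 2 =
      ∑ k ∈ range 9, ∑ l ∈ range 9, A * (zetaN Vs qs k * zetaN Vs qs l) * (dispN ΔU Δξ k * dispN ΔU Δξ l) := by
    rw [sq, Finset.sum_mul_sum, Finset.mul_sum]
    exact Finset.sum_congr rfl fun k _ => by rw [Finset.mul_sum]; exact Finset.sum_congr rfl fun l _ => by ring
  rw [inner_smul_right, inner_y_dy_eq_sum Vs ΔU hsym qs Δξ, e1, e2, ← Finset.sum_add_distrib]
  exact Finset.sum_congr rfl fun k _ => by rw [← Finset.sum_add_distrib]; exact Finset.sum_congr rfl fun l _ => by ring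

/-! ## §5. ★★ The Hessian entry along the path inside one open regime: derivative `Σ_m T_klm δ_m` -/

/-- The radius along the path has derivative `(Σ_m ζ_m δ_m)/ρ`. [folklore] -/
theorem hasDerivAt_rho_label (hsym : ∀ a b : Fin 3, ent ΔU a b = ent ΔU b a) {s : ℝ} (h0 : (V + s • ΔU) (q + s • Δξ) ≠ 0) :
    HasDerivAt (fun t : ℝ => ‖(V + t • ΔU) (q + t • Δξ)‖)
      ((∑ m ∈ range 9, zetaN (V + s • ΔU) (q + s • Δξ) m * dispN ΔU Δξ m) / ‖(V + s • ΔU) (q + s • Δξ)‖) s := by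
  have h := hasDerivAt_norm_path (hasDerivAt_labelPath V ΔU q Δξ s) h0
  rw [inner_y_dy_eq_sum (V + s • ΔU) ΔU hsym (q + s • Δξ) Δξ] at h
  exact h

/-- Regrouping of the derivative of `αζ_kζ_l + βν_kl` into `Σ_m T_klm δ_m` (pure algebra). [arithmetic] -/
theorem thirdSum_regroup (Z Nk Nl Om d : ℕ → ℝ) (zk zl nkl a A B : ℝ) :
    ∑ m ∈ range 9, (Z m * (a * (zk * zl) + A * nkl) + A * Nk m * zl + A * Nl m * zk + B * Om m) * d m =
      a * (∑ m ∈ range 9, Z m * d m) * (zk * zl) + A * ((∑ m ∈ range 9, Nk m * d m) * zl + zk * ∑ m ∈ range 9, Nl m * d m) +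
        (A * (∑ m ∈ range 9, Z m * d m) * nkl + B * ∑ m ∈ range 9, Om m * d m) := by
  simp only [Finset.mul_sum, Finset.sum_mul, ← Finset.sum_add_distrib]
  exact Finset.sum_congr rfl fun m _ => by ring

/-- ★★★ **THE HESSIAN ENTRY ALONG THE PATH.**  Inside one open regime — i.e. given the derivative chain of the true coefficients at `ρ_s`
(`HasDerivAt α (a₁ρ_s) ρ_s`, `HasDerivAt β (α(ρ_s)ρ_s) ρ_s`, as supplied by `…SoundN.coefL_lip`) — the folded Hessian entry
`H_kl(t) = α(ρ_t)ζ_k(t)ζ_l(t) + β(ρ_t)ν_kl(t)` is differentiable at `s` with derivative `Σ_m T_klm δ_m`,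
`T_klm = ζ_m(a₁ζ_kζ_l + αν_kl) + αν_km ζ_l + αν_lm ζ_k + βω_klm` — the real expression enclosed by `…SoundN.mem_thirdOf` (`a = k`, `b = l`).
[folklore: chain + product rules, §3] -/
theorem hasDerivAt_hessEntry_label (hsym : ∀ a b : Fin 3, ent ΔU a b = ent ΔU b a) {k l : ℕ} (hk : k < 9) (hl : l < 9) {s : ℝ}
    (h0 : 0 < ‖(V + s • ΔU) (q + s • Δξ)‖) {a₁ : ℝ}
    (hα : HasDerivAt (fun r => (deriv (deriv (effPot w₄₅ ω₄ (3 / 400))) r - deriv (effPot w₄₅ ω₄ (3 / 400)) r / r) / r ^ 2)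
      (a₁ * ‖(V + s • ΔU) (q + s • Δξ)‖) ‖(V + s • ΔU) (q + s • Δξ)‖)
    (hβ : HasDerivAt (fun r => deriv (effPot w₄₅ ω₄ (3 / 400)) r / r)
      ((deriv (deriv (effPot w₄₅ ω₄ (3 / 400))) ‖(V + s • ΔU) (q + s • Δξ)‖ -
          deriv (effPot w₄₅ ω₄ (3 / 400)) ‖(V + s • ΔU) (q + s • Δξ)‖ / ‖(V + s • ΔU) (q + s • Δξ)‖) / ‖(V + s • ΔU) (q + s • Δξ)‖ ^ 2 *
        ‖(V + s • ΔU) (q + s • Δξ)‖) ‖(V + s • ΔU) (q + s • Δξ)‖) :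
    HasDerivAt (fun t : ℝ =>
        (deriv (deriv (effPot w₄₅ ω₄ (3 / 400))) ‖(V + t • ΔU) (q + t • Δξ)‖ -
              deriv (effPot w₄₅ ω₄ (3 / 400)) ‖(V + t • ΔU) (q + t • Δξ)‖ / ‖(V + t • ΔU) (q + t • Δξ)‖) / ‖(V + t • ΔU) (q + t • Δξ)‖ ^ 2 *
            (zetaN (V + t • ΔU) (q + t • Δξ) k * zetaN (V + t • ΔU) (q + t • Δξ) l) +
          deriv (effPot w₄₅ ω₄ (3 / 400)) ‖(V + t • ΔU) (q + t • Δξ)‖ / ‖(V + t • ΔU) (q + t • Δξ)‖ * nuR (V + t • ΔU) (q + t • Δξ) k l)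
      (∑ m ∈ range 9,
        (zetaN (V + s • ΔU) (q + s • Δξ) m *
              (a₁ * (zetaN (V + s • ΔU) (q + s • Δξ) k * zetaN (V + s • ΔU) (q + s • Δξ) l) +
                (deriv (deriv (effPot w₄₅ ω₄ (3 / 400))) ‖(V + s • ΔU) (q + s • Δξ)‖ -
                      deriv (effPot w₄₅ ω₄ (3 / 400)) ‖(V + s • ΔU) (q + s • Δξ)‖ / ‖(V + s • ΔU) (q + s • Δξ)‖) /
                    ‖(V + s • ΔU) (q + s • Δξ)‖ ^ 2 *
                  nuR (V + s • ΔU) (q + s • Δξ) k l) +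
            (deriv (deriv (effPot w₄₅ ω₄ (3 / 400))) ‖(V + s • ΔU) (q + s • Δξ)‖ -
                  deriv (effPot w₄₅ ω₄ (3 / 400)) ‖(V + s • ΔU) (q + s • Δξ)‖ / ‖(V + s • ΔU) (q + s • Δξ)‖) / ‖(V + s • ΔU) (q + s • Δξ)‖ ^ 2 *
                nuR (V + s • ΔU) (q + s • Δξ) k m * zetaN (V + s • ΔU) (q + s • Δξ) l +
            (deriv (deriv (effPot w₄₅ ω₄ (3 / 400))) ‖(V + s • ΔU) (q + s • Δξ)‖ -
                  deriv (effPot w₄₅ ω₄ (3 / 400)) ‖(V + s • ΔU) (q + s • Δξ)‖ / ‖(V + s • ΔU) (q + s • Δξ)‖) / ‖(V + s • ΔU) (q + s • Δξ)‖ ^ 2 *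
                nuR (V + s • ΔU) (q + s • Δξ) l m * zetaN (V + s • ΔU) (q + s • Δξ) k +
            deriv (effPot w₄₅ ω₄ (3 / 400)) ‖(V + s • ΔU) (q + s • Δξ)‖ / ‖(V + s • ΔU) (q + s • Δξ)‖ *
              (∑ cc : Fin 3, (dyR (V + s • ΔU) (q + s • Δξ) l cc * ddyR m k cc + dyR (V + s • ΔU) (q + s • Δξ) k cc * ddyR m l cc +
                dyR (V + s • ΔU) (q + s • Δξ) m cc * ddyR k l cc))) *
          dispN ΔU Δξ m) s := by
  have hne : ‖(V + s • ΔU) (q + s • Δξ)‖ ≠ 0 := h0.ne'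
  have hy0 : (V + s • ΔU) (q + s • Δξ) ≠ 0 := norm_ne_zero_iff.1 hne
  have hρ := hasDerivAt_rho_label hsym hy0
  have hαt := hα.comp s hρ
  have hβt := hβ.comp s hρ
  have hζk := hasDerivAt_zetaN_path V ΔU q Δξ hsym hk s
  have hζl := hasDerivAt_zetaN_path V ΔU q Δξ hsym hl s
  have hν := hasDerivAt_nuR_path V ΔU q Δξ hsym hk hl s
  have h := (hαt.mul (hζk.mul hζl)).add (hβt.mul hν)
  refine h.congr_deriv ?_
  simp only [Function.comp_apply, Pi.mul_apply]
  set Vs := V + s • ΔU with hVs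
  set qs := q + s • Δξ with hqs
  set B := deriv (effPot w₄₅ ω₄ (3 / 400)) ‖Vs qs‖ / ‖Vs qs‖ with hB
  set A := (deriv (deriv (effPot w₄₅ ω₄ (3 / 400))) ‖Vs qs‖ - B) / ‖Vs qs‖ ^ 2 with hA
  -- cancel the `ρ` of the chain rule
  have c1 : a₁ * ‖Vs qs‖ * ((∑ m ∈ range 9, zetaN Vs qs m * dispN ΔU Δξ m) / ‖Vs qs‖) = a₁ * ∑ m ∈ range 9, zetaN Vs qs m * dispN ΔU Δξ m := by
    rw [mul_assoc, mul_div_cancel₀ _ hne]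
  have c2 : A * ‖Vs qs‖ * ((∑ m ∈ range 9, zetaN Vs qs m * dispN ΔU Δξ m) / ‖Vs qs‖) = A * ∑ m ∈ range 9, zetaN Vs qs m * dispN ΔU Δξ m := by
    rw [mul_assoc, mul_div_cancel₀ _ hne]
  have key := thirdSum_regroup (fun m => zetaN Vs qs m) (fun m => nuR Vs qs k m) (fun m => nuR Vs qs l m)
    (fun m => ∑ cc : Fin 3, (dyR Vs qs l cc * ddyR m k cc + dyR Vs qs k cc * ddyR m l cc + dyR Vs qs m cc * ddyR k l cc))
    (fun m => dispN ΔU Δξ m) (zetaN Vs qs k) (zetaN Vs qs l) (nuR Vs qs k l) a₁ A B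
  rw [c1, c2, key]

/-! ## §6. ★ The radius of a quadratic path meets a given value only finitely often -/

/-- `‖y₀ + t y₁ + t² y₂‖² − r²` is the evaluation at `t` of an explicit real polynomial of degree `≤ 4`. [arithmetic] -/
theorem normSq_quadPath_eq_eval (y₀ y₁ y₂ : E3) (r t : ℝ) :
    ‖y₀ + t • y₁ + t ^ 2 • y₂‖ ^ 2 - r ^ 2 =
      (Polynomial.C (‖y₀‖ ^ 2 - r ^ 2) + Polynomial.C (2 * ⟪y₀, y₁⟫) * Polynomial.X +
        Polynomial.C (‖y₁‖ ^ 2 + 2 * ⟪y₀, y₂⟫) * Polynomial.X ^ 2 + Polynomial.C (2 * ⟪y₁, y₂⟫) * Polynomial.X ^ 3 +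
        Polynomial.C (‖y₂‖ ^ 2) * Polynomial.X ^ 4).eval t := by
  simp only [Polynomial.eval_add, Polynomial.eval_mul, Polynomial.eval_C, Polynomial.eval_X, Polynomial.eval_pow]
  rw [← real_inner_self_eq_norm_sq (y₀ + t • y₁ + t ^ 2 • y₂), ← real_inner_self_eq_norm_sq y₀, ← real_inner_self_eq_norm_sq y₁,
    ← real_inner_self_eq_norm_sq y₂]
  simp only [inner_add_left, inner_add_right, inner_smul_left, inner_smul_right, RCLike.conj_to_real]
  rw [real_inner_comm y₁ y₀, real_inner_comm y₂ y₀, real_inner_comm y₂ y₁]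
  ring

/-- ★ **FINITELY MANY PARAMETERS AT A GIVEN RADIUS**: if `‖y₀‖ ≠ r` (`r ≥ 0`) then `{t | ‖y₀ + t y₁ + t² y₂‖ = r}` is finite. [folklore: a nonzero
polynomial has finitely many roots] -/
theorem finite_quadPath_normEq {y₀ y₁ y₂ : E3} {r : ℝ} (hr : 0 ≤ r) (h : ‖y₀‖ ≠ r) :
    Set.Finite {t : ℝ | ‖y₀ + t • y₁ + t ^ 2 • y₂‖ = r} := by
  set p : Polynomial ℝ := Polynomial.C (‖y₀‖ ^ 2 - r ^ 2) + Polynomial.C (2 * ⟪y₀, y₁⟫) * Polynomial.X +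
    Polynomial.C (‖y₁‖ ^ 2 + 2 * ⟪y₀, y₂⟫) * Polynomial.X ^ 2 + Polynomial.C (2 * ⟪y₁, y₂⟫) * Polynomial.X ^ 3 +
    Polynomial.C (‖y₂‖ ^ 2) * Polynomial.X ^ 4 with hp
  have hsq : ‖y₀‖ ^ 2 - r ^ 2 ≠ 0 := by
    intro h0
    have : ‖y₀‖ ^ 2 = r ^ 2 := sub_eq_zero.1 h0
    have := (sq_eq_sq₀ (norm_nonneg _) hr).1 this
    exact h this
  have hp0 : p ≠ 0 := by
    intro hzero
    have h1 : ‖y₀ + (0 : ℝ) • y₁ + (0 : ℝ) ^ 2 • y₂‖ ^ 2 - r ^ 2 = p.eval 0 := normSq_quadPath_eq_eval y₀ y₁ y₂ r 0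
    rw [hzero, Polynomial.eval_zero] at h1
    simp at h1
    exact hsq (by rw [h1])
  refine (Polynomial.finite_setOf_isRoot hp0).subset fun t ht => ?_
  simp only [Set.mem_setOf_eq] at ht ⊢
  rw [Polynomial.IsRoot.def, ← normSq_quadPath_eq_eval, ht, sub_self]

/-- The junction radii are nonnegative. [arithmetic] -/
theorem junctions_nonneg {r : ℝ} (hr : r ∈ junctions) : 0 ≤ r := by
  have : r = 8 / 5 ∨ r = 3 ∨ r = 9 / 2 := by simpa [junctions] using hr
  rcases this with h | h | h <;> rw [h] <;> norm_num

/-- ★★ **FINITELY MANY JUNCTION PARAMETERS** on a quadratic path whose starting radius is off the junction radii. [folklore] -/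
theorem finite_quadPath_junctions {y₀ y₁ y₂ : E3} (h : ‖y₀‖ ∉ junctions) :
    Set.Finite {t : ℝ | ‖y₀ + t • y₁ + t ^ 2 • y₂‖ ∈ junctions} := by
  have e : {t : ℝ | ‖y₀ + t • y₁ + t ^ 2 • y₂‖ ∈ junctions} = ⋃ r ∈ (junctions : Set ℝ), {t : ℝ | ‖y₀ + t • y₁ + t ^ 2 • y₂‖ = r} := by
    ext t
    simp only [Set.mem_setOf_eq, Set.mem_iUnion, exists_prop]
    exact ⟨fun ht => ⟨_, ht, rfl⟩, fun ⟨r, hr, hrt⟩ => hrt ▸ hr⟩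
  rw [e]
  refine Set.Finite.biUnion (junctions.finite_toSet) fun r hr => ?_
  exact finite_quadPath_normEq (junctions_nonneg hr) (fun heq => h (heq ▸ hr))

/-- ★★ **THE JUNCTION PARAMETERS OF A LABEL** along the bilinear segment form a finite set, provided the label's radius at the CENTRE (`t = 0`) is off
the junction radii. [folklore chaining: `labelPath_eq` + `finite_quadPath_junctions`] -/
theorem finite_label_junctions (V ΔU : E3 →L[ℝ] E3) (q Δξ : E3) (h : ‖V q‖ ∉ junctions) :
    Set.Finite {t : ℝ | ‖(V + t • ΔU) (q + t • Δξ)‖ ∈ junctions} := by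
  have e : {t : ℝ | ‖(V + t • ΔU) (q + t • Δξ)‖ ∈ junctions} = {t : ℝ | ‖V q + t • (ΔU q + V Δξ) + t ^ 2 • ΔU Δξ‖ ∈ junctions} := by
    ext t; simp only [Set.mem_setOf_eq, labelPath_eq]
  rw [e]
  exact finite_quadPath_junctions h

end Path

end Summit.AtomisticToContinuum.Crystallization.Theorems.FrustratedLawDichotomyStrainedPatchHomValueT2Kit
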